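import Summits.RiemannHypothesis.RiemannHypothesis.Theorems.SuzukiFlowPairingOperatorSide
import Summits.RiemannHypothesis.RiemannHypothesis.Theorems.SuzukiFlowPairingWeilValue

/-!
# `FlowPairing t` — the pairing identity of the θ-flow, PROVED (column DBR; RH-FREE)

RH-FREE throughout; nothing here bears on the truth of RH.  The ONE remaining identity under the θ-flow
identity (T0) of the crux idea `theta-flow-weil-window` (`Theorems.SuzukiThetaFlowDefs.FlowPairing`):
for `θ > 1` and `f ∈ L²(−t,t)`, `2⟨𝖪_θ[t]f, 𝒥_θ[t]f⟩_{L²(−t,t)} = −2·Re weilQuadratic(g_θ)`, `g_θ = winOut θ t f`.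

Both sides are now explicit `x`-side functionals of the window pairing `Φ(v) = ∫_{(−t,t)} G(x)G(x−v)dx`
(`G = 𝖪_θ[t]f`): the operator side by `Theorems.SuzukiFlowPairingOperatorSide.integral_winOp_mul_winOp_flowKernel`,
the Weil side by `Theorems.SuzukiFlowPairingWeilValue.weilQuadratic_winOut_eq` (with the pairing lemma
`φ(v) = Φ(|v|)`, `φ = g_θ ⋆ g̃_θ`).  This file matches them term by term (polar, prime, archimedean/digamma) and
concludes **`flowPairing : FlowPairing t`** for every real `t`; hence (T0) `thetaFlowIdentity` by
`thetaFlowIdentity_of_flowPairing`.  The `∀ t` antitone level of the card remains RH-EQUIVALENT (Weil's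
criterion re-indexed) and is NOT claimed; `SuzukiThetaFlowChain.rungTwelveOne_of_flowPairing` still needs
`WeilNonnegOnOutputs` and the kit-certified `Anchor 12 1`.

References: [Su20] M. Suzuki, ASPM 84 (2020), (1.4), (1.9); E. Bombieri, Rend. Lincei (9) 11 (2000), Thm 2.
-/

noncomputable section

-- D-0017: `Summit.<S>.<S>.…` is the designed namespace of a single-problem summit.
set_option linter.dupNamespace false

open Complex MeasureTheory Set Filter Topology
open scoped Real ArithmeticFunction.vonMangoldt

namespace Summit.RiemannHypothesis.RiemannHypothesis.Theorems.SuzukiThetaFlow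

open Literature.NumberTheory.LFunctions
open Summit.RiemannHypothesis.RiemannHypothesis.Theorems.SuzukiKernelSemigroup
open Summit.RiemannHypothesis.RiemannHypothesis.Theorems.SuzukiFlowPairing

variable {θ t : ℝ} {f : ℝ → ℝ}

/-- RH-FREE.  On `x ≥ 0` the symmetrised autocorrelation is twice the window pairing:
`φ(x) + φ(−x) = 2·Φ(x)` (pairing lemma + evenness). -/
theorem autocorr_add_autocorr_neg (hθ : 1 < θ) (t : ℝ) (f : ℝ → ℝ) {x : ℝ} (hx : 0 ≤ x) :
    weilConv (winOut θ t f) (weilReflect (winOut θ t f)) x + weilConv (winOut θ t f) (weilReflect (winOut θ t f)) (-x) =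
      (((2 * ∫ u in Ioo (-t) t, winOp (limKernel θ) t f u * winOp (limKernel θ) t f (u - x) : ℝ)) : ℂ) := by
  rw [(weilConv_winOut_weilReflect_even hθ t f x).1, weilConv_winOut_weilReflect_of_nonneg hθ t f hx]
  push_cast
  ring

/-- RH-FREE.  `Φ` is integrable against any exponential weight on `(0,∞)` (it is the real part of the
continuous compactly supported `φ` there). -/
theorem integrableOn_exp_mul_pairing (hθ : 1 < θ) (hf : IntegrableOn f (Ioo (-t) t)) (a : ℝ) :
    IntegrableOn (fun v : ℝ ↦ Real.exp (a * v) *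
      ∫ u in Ioo (-t) t, winOp (limKernel θ) t f u * winOp (limKernel θ) t f (u - v)) (Ioi 0) := by
  have hc := continuous_autocorr_winOut hθ hf
  have hs := hasCompactSupport_weilConv_winOut_weilReflect hθ t f
  have hI : Integrable fun v : ℝ ↦ Real.exp (a * v) *
      (weilConv (winOut θ t f) (weilReflect (winOut θ t f)) v).re :=
    ((Real.continuous_exp.comp (by fun_prop)).mul (Complex.continuous_re.comp hc)).integrable_of_hasCompactSupport
      ((hs.comp_left Complex.zero_re).mul_left)
  refine hI.integrableOn.congr_fun (fun v hv ↦ ?_) measurableSet_Ioi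
  dsimp only
  rw [weilConv_winOut_weilReflect_of_nonneg hθ t f (le_of_lt (mem_Ioi.1 hv)), Complex.ofReal_re]

/-- RH-FREE.  POLAR: `∫₀^∞ (φ(x)+φ(−x))(e^{−x/2}+e^{x/2}) dx = ↑(2∫₀^∞e^{−v/2}Φ + 2∫₀^∞e^{v/2}Φ)`. -/
theorem polar_autocorr_winOut (hθ : 1 < θ) (hf : IntegrableOn f (Ioo (-t) t)) :
    ∫ x in Ioi (0 : ℝ), (weilConv (winOut θ t f) (weilReflect (winOut θ t f)) x +
        weilConv (winOut θ t f) (weilReflect (winOut θ t f)) (-x)) * (cexp (-(x : ℂ) / 2) + cexp ((x : ℂ) / 2)) =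
      (((2 * (∫ v in Ioi (0 : ℝ), Real.exp (-(1 / 2) * v) *
          ∫ u in Ioo (-t) t, winOp (limKernel θ) t f u * winOp (limKernel θ) t f (u - v)) +
        2 * (∫ v in Ioi (0 : ℝ), Real.exp (1 / 2 * v) *
          ∫ u in Ioo (-t) t, winOp (limKernel θ) t f u * winOp (limKernel θ) t f (u - v)) : ℝ)) : ℂ) := by
  have h1 := integrableOn_exp_mul_pairing hθ hf (-(1 / 2))
  have h2 := integrableOn_exp_mul_pairing hθ hf (1 / 2)
  rw [← integral_const_mul, ← integral_const_mul, ← integral_add (h1.const_mul 2) (h2.const_mul 2),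
    ← integral_complex_ofReal]
  refine setIntegral_congr_fun measurableSet_Ioi fun x hx ↦ ?_
  rw [autocorr_add_autocorr_neg hθ t f (le_of_lt (mem_Ioi.1 hx))]
  have e1 : cexp (-(x : ℂ) / 2) = ((Real.exp (-(1 / 2) * x) : ℝ) : ℂ) := by
    rw [Complex.ofReal_exp]; congr 1; push_cast; ring
  have e2 : cexp ((x : ℂ) / 2) = ((Real.exp (1 / 2 * x) : ℝ) : ℂ) := by
    rw [Complex.ofReal_exp]; congr 1; push_cast; ring
  rw [e1, e2]
  push_cast
  ring

/-- RH-FREE.  PRIME: `weilPrimeTerm φ = ↑(2 Σ' Λ(n) n^{−1/2} Φ(log n))`. -/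
theorem weilPrimeTerm_autocorr_winOut (hθ : 1 < θ) (t : ℝ) (f : ℝ → ℝ) :
    weilPrimeTerm (weilConv (winOut θ t f) (weilReflect (winOut θ t f))) =
      (((2 * ∑' n : ℕ, (Λ n : ℝ) * (n : ℝ) ^ (-(1 / 2 : ℝ)) *
        ∫ u in Ioo (-t) t, winOp (limKernel θ) t f u * winOp (limKernel θ) t f (u - Real.log n) : ℝ)) : ℂ) := by
  unfold weilPrimeTerm
  rw [← tsum_mul_left, Complex.ofReal_tsum]
  refine tsum_congr fun n ↦ ?_
  rw [autocorr_add_autocorr_neg hθ t f (Real.log_natCast_nonneg n), ← Complex.ofReal_div, ← Complex.ofReal_mul]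
  congr 1
  rw [Real.sqrt_eq_rpow, div_eq_mul_inv, ← Real.rpow_neg (Nat.cast_nonneg n)]
  ring

/-- RH-FREE.  ARCH SERIES: the Bombieri series of `φ` is `↑(4π Σ'_k (Φ(0)/(k+1) − 2∫₀^∞e^{−(2k+½)v}Φ))`. -/
theorem archSeries_autocorr_winOut (hθ : 1 < θ) (t : ℝ) (f : ℝ → ℝ) :
    (∑' n : ℕ, (4 * π * weilConv (winOut θ t f) (weilReflect (winOut θ t f)) 0 / ((n : ℂ) + 1) -
        4 * π * ∫ x in Ioi (0 : ℝ), (weilConv (winOut θ t f) (weilReflect (winOut θ t f)) x +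
          weilConv (winOut θ t f) (weilReflect (winOut θ t f)) (-x)) * cexp ((-(2 * (n : ℂ)) - 1 / 2) * x))) =
      (((4 * π * ∑' k : ℕ, ((∫ u in Ioo (-t) t, winOp (limKernel θ) t f u * winOp (limKernel θ) t f u) / ((k : ℝ) + 1) -
        2 * ∫ v in Ioi (0 : ℝ), Real.exp ((-2 * (k : ℝ) - 1 / 2) * v) *
          ∫ u in Ioo (-t) t, winOp (limKernel θ) t f u * winOp (limKernel θ) t f (u - v)) : ℝ)) : ℂ) := by
  have h0 : weilConv (winOut θ t f) (weilReflect (winOut θ t f)) 0 =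
      (((∫ u in Ioo (-t) t, winOp (limKernel θ) t f u * winOp (limKernel θ) t f u : ℝ)) : ℂ) := by
    rw [weilConv_winOut_weilReflect_of_nonneg hθ t f le_rfl]
    congr 1
    refine setIntegral_congr_fun measurableSet_Ioo fun u _ ↦ by rw [sub_zero]
  rw [← tsum_mul_left, Complex.ofReal_tsum]
  refine tsum_congr fun k ↦ ?_
  have hI : ∫ x in Ioi (0 : ℝ), (weilConv (winOut θ t f) (weilReflect (winOut θ t f)) x +
      weilConv (winOut θ t f) (weilReflect (winOut θ t f)) (-x)) * cexp ((-(2 * (k : ℂ)) - 1 / 2) * x) =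
      (((2 * ∫ v in Ioi (0 : ℝ), Real.exp ((-2 * (k : ℝ) - 1 / 2) * v) *
        ∫ u in Ioo (-t) t, winOp (limKernel θ) t f u * winOp (limKernel θ) t f (u - v) : ℝ)) : ℂ) := by
    rw [← integral_const_mul, ← integral_complex_ofReal]
    refine setIntegral_congr_fun measurableSet_Ioi fun x hx ↦ ?_
    have e : cexp ((-(2 * (k : ℂ)) - 1 / 2) * x) = ((Real.exp ((-2 * (k : ℝ) - 1 / 2) * x) : ℝ) : ℂ) := by
      rw [Complex.ofReal_exp]; congr 1; push_cast; ring
    rw [autocorr_add_autocorr_neg hθ t f (le_of_lt (mem_Ioi.1 hx)), e, ← Complex.ofReal_mul]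
    congr 1
    ring
  rw [h0, hI]
  push_cast
  ring

/-- RH-FREE.  **The Weil side as a real number**: `Re weilQuadratic(g_θ) = −X` with `X` the operator-side
functional of `integral_winOp_mul_winOp_flowKernel`. -/
theorem re_weilQuadratic_winOut (hθ : 1 < θ) (hf : IntegrableOn f (Ioo (-t) t)) :
    (weilQuadratic (winOut θ t f)).re =
      -(-2 * (∫ v in Ioi (0 : ℝ), Real.exp (-(1 / 2) * v) *
          ∫ x in Ioo (-t) t, winOp (limKernel θ) t f x * winOp (limKernel θ) t f (x - v)) +
      (-2) * (∫ v in Ioi (0 : ℝ), Real.exp (1 / 2 * v) *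
          ∫ x in Ioo (-t) t, winOp (limKernel θ) t f x * winOp (limKernel θ) t f (x - v)) +
      (Real.log Real.pi + Real.eulerMascheroniConstant) *
        (∫ x in Ioo (-t) t, winOp (limKernel θ) t f x * winOp (limKernel θ) t f x) -
      (∑' k : ℕ, ((∫ x in Ioo (-t) t, winOp (limKernel θ) t f x * winOp (limKernel θ) t f x) / ((k : ℝ) + 1) -
        2 * ∫ v in Ioi (0 : ℝ), Real.exp ((-2 * (k : ℝ) - 1 / 2) * v) *
          ∫ x in Ioo (-t) t, winOp (limKernel θ) t f x * winOp (limKernel θ) t f (x - v))) +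
      2 * ∑' n : ℕ, (Λ n : ℝ) * (n : ℝ) ^ (-(1 / 2 : ℝ)) *
        ∫ x in Ioo (-t) t, winOp (limKernel θ) t f x * winOp (limKernel θ) t f (x - Real.log n)) := by
  rw [weilQuadratic_winOut_eq hθ hf, polar_autocorr_winOut hθ hf, weilPrimeTerm_autocorr_winOut hθ t f,
    archSeries_autocorr_winOut hθ t f, weilConv_winOut_weilReflect_of_nonneg hθ t f le_rfl]
  have h0 : (∫ u in Ioo (-t) t, winOp (limKernel θ) t f u * winOp (limKernel θ) t f (u - 0)) =
      ∫ u in Ioo (-t) t, winOp (limKernel θ) t f u * winOp (limKernel θ) t f u :=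
    setIntegral_congr_fun measurableSet_Ioo fun u _ ↦ by rw [sub_zero]
  rw [h0]
  set I₁ : ℝ := ∫ v in Ioi (0 : ℝ), Real.exp (-(1 / 2) * v) *
    ∫ x in Ioo (-t) t, winOp (limKernel θ) t f x * winOp (limKernel θ) t f (x - v) with hI₁
  set I₂ : ℝ := ∫ v in Ioi (0 : ℝ), Real.exp (1 / 2 * v) *
    ∫ x in Ioo (-t) t, winOp (limKernel θ) t f x * winOp (limKernel θ) t f (x - v) with hI₂
  set Φ₀ : ℝ := ∫ x in Ioo (-t) t, winOp (limKernel θ) t f x * winOp (limKernel θ) t f x with hΦ₀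
  set D : ℝ := ∑' k : ℕ, (Φ₀ / ((k : ℝ) + 1) -
    2 * ∫ v in Ioi (0 : ℝ), Real.exp ((-2 * (k : ℝ) - 1 / 2) * v) *
      ∫ x in Ioo (-t) t, winOp (limKernel θ) t f x * winOp (limKernel θ) t f (x - v)) with hD
  set P : ℝ := ∑' n : ℕ, (Λ n : ℝ) * (n : ℝ) ^ (-(1 / 2 : ℝ)) *
    ∫ x in Ioo (-t) t, winOp (limKernel θ) t f x * winOp (limKernel θ) t f (x - Real.log n) with hP
  have hW : ((((2 * I₁ + 2 * I₂ : ℝ)) : ℂ) - (((2 * P : ℝ)) : ℂ) +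
      ((1 / (2 * π) : ℂ) * (((((4 * π * D : ℝ)) : ℂ) - 4 * π * Real.eulerMascheroniConstant * ((Φ₀ : ℝ) : ℂ)) / 2) -
        ((Φ₀ : ℝ) : ℂ) * (Real.log π : ℂ))) =
      (((2 * I₁ + 2 * I₂ - 2 * P + (1 / (2 * π) * ((4 * π * D - 4 * π * Real.eulerMascheroniConstant * Φ₀) / 2) -
        Φ₀ * Real.log π) : ℝ)) : ℂ) := by
    push_cast
    ring
  rw [hW, Complex.ofReal_re]
  field_simp
  ring

/-- **RH-FREE · `FlowPairing t` HOLDS** for every real `t`: for `θ > 1` and `f ∈ L²(−t,t)`,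
`∫_{(−t,t)} 2(𝖪_θ[t]f)(𝒥_θ[t]f) = −2·Re weilQuadratic(winOut θ t f)`.  (Operator side
`integral_winOp_mul_winOp_flowKernel` against Weil side `weilQuadratic_winOut_eq`, matched through the pairing
lemma.)  Consequently the θ-flow identity (T0) holds: `thetaFlowIdentity_of_flowPairing (flowPairing t)`.  The
`∀ t` antitone level is RH-EQUIVALENT and not claimed; nothing here bears on the truth of RH. -/
theorem flowPairing (t : ℝ) : FlowPairing t := by
  intro θ hθ f hf2
  have hf : IntegrableOn f (Ioo (-t) t) := by
    haveI : IsFiniteMeasure (winMeasure t) := by unfold winMeasure; infer_instance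
    exact hf2.integrable one_le_two
  have hL : ∫ x in Ioo (-t) t, 2 * winOp (limKernel θ) t f x * winOp (flowKernel θ) t f x =
      2 * ∫ x in Ioo (-t) t, winOp (limKernel θ) t f x * winOp (flowKernel θ) t f x := by
    rw [← integral_const_mul]
    refine setIntegral_congr_fun measurableSet_Ioo fun x _ ↦ by ring
  rw [hL, integral_winOp_mul_winOp_flowKernel hθ hf, re_weilQuadratic_winOut hθ hf]
  ring

/-- **RH-FREE · (T0) the θ-flow identity**: `ThetaFlowIdentity t` for every real `t`. -/
theorem thetaFlowIdentity (t : ℝ) : ThetaFlowIdentity t := thetaFlowIdentity_of_flowPairing (flowPairing t)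

end Summit.RiemannHypothesis.RiemannHypothesis.Theorems.SuzukiThetaFlow

end
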